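import Summits.AnomalousDissipation.AnomalousDissipation.Theses.PumpedMirror
import Summits.AnomalousDissipation.AnomalousDissipation.Theorems.PumpedMirrorMirrorBoundedFromRestTGStubMirrorSchemeFromRest
import Summits.AnomalousDissipation.AnomalousDissipation.Theorems.TaylorCertificatesZeroDatumLerayHopf
import Literature.Analysis.FluidPDE.NSHopfGalerkinLimit
import Literature.Analysis.FunctionSpaces.TorusVectorParseval

/-!
# Stub `stub_limitInheritsMirrorBound` of the line `registered` (birth skeleton)
# (crux stmt-AnomalousDissipation-15373, `PumpedMirror.MirrorBoundedFromRestTG`)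

**A bounded `K`-symmetric exact-force Hopf–Galerkin scheme from rest has a bounded `K`-symmetric Leray–Hopf
limit.** For ONE fixed `ν > 0` and a Hopf–Galerkin scheme `(N, U)` for `(ν, f_TG, 0)`
(`Literature.Analysis.FluidPDE.IsHopfGalerkinScheme`, force pinned exactly) whose slices `U n t`, `t ≥ 0`, are
pointwise `K`-symmetric (`U n t (R_i x) j = (−1)^{δ_ij} U n t x j`, `R_i x = update x i (−x i)`) and bounded in
`L²` by `E` (`∫ |U n t|² ≤ E`), there is a global Leray–Hopf solution `u` from rest with an `H`-lift `V`
(`V t = u t` a.e., `t ≥ 0`) that is `K`-symmetric a.e. and obeys `‖V t‖² ≤ E` for all `t ≥ 0`.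

Proof (Robinson–Rodrigo–Sadowski 2016, Thm. 4.4 Steps 3–4, all IN TREE, plus two passages to the limit):
* the limit field `u` of `IsHopfGalerkinScheme.exists_limitField` (coefficientwise limit of EVERY slice `t ≥ 0`
  along a subsequence) is Leray–Hopf on every `[0, T)` (`IsHopfGalerkinScheme.isLerayHopfOn_limit`, along the
  subsequence `IsHopfGalerkinScheme.comp_strictMono`), and has the `H`-lift of
  `exists_energySpace_lift_of_isGlobalLerayHopf_zero` (`f_TG` smooth with zero mean);
* the bound: `‖V t‖² = ∫ |u t|² = ∑ₖ |û(t,k)|²` (Parseval) and every finite partial sum is a limit of partial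
  sums of `∑ₖ |Û_{φ j}(t,k)|² ≤ ∫ |U (φ j) t|² ≤ E` (Bessel) — Fatou–Parseval
  (`integral_norm_sq_le_of_tendsto_mFourierCoeff`, the pattern of `IsHopfGalerkinScheme.sum_norm_sq_limit_le`);
* the symmetry: `K`-symmetry of a continuous slice is the closed linear coefficient relation
  `Û (k R_i) = R_iℂ (Û k)` (`SchemeFromRest.mFourierCoeff_mirror_of_isKSymm`), preserved under pointwise limits
  of coefficients (`mirror_coeff_of_tendsto`); an `L²` field with mirror-related coefficients is `K`-symmetric
  a.e. (`ae_mirror_of_mFourierCoeff_mirror`: both `u ∘ R_i` and `R_i ∘ u` are in `L²` with the same coefficients,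
  `Torus.mFourierCoeff_comp_mulVecT` and `Torus.ae_eq_of_mFourierCoeff_complexify_eq`); the relation is transported
  to the lift along `V t = u t` a.e. (`R_i` is measure preserving, `Torus.measurePreserving_mulVecT`).

Sources: E. Hopf, Math. Nachr. 4 (1951) §4; J. C. Robinson, J. L. Rodrigo, W. Sadowski, *The three-dimensional
Navier–Stokes equations* (CUP 2016), Thm. 4.4 Steps 3–4, (4.10); M. E. Brachet et al., J. Fluid Mech. 130 (1983)
§2 (symmetries of the Taylor–Green vortex); L. Grafakos, *Classical Fourier Analysis* (2014), Prop. 3.2.7.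
-/

-- `Summit.<Summit>.<Problem>` is the tree's mandated summit-side namespace (CONVENTIONS §2); for this
-- single-conjunct summit the two coincide, so the duplicate is deliberate.
set_option linter.dupNamespace false

noncomputable section

open scoped BigOperators Topology ENNReal
open MeasureTheory Set Filter Function UnitAddTorus
open Literature.Analysis.FunctionSpaces Literature.Analysis.FunctionSpaces.Torus
open Literature.Analysis.FluidPDE Literature.Analysis.FluidPDE.Torus

namespace Summit.AnomalousDissipation.AnomalousDissipation.Theorems.PumpedMirror.MirrorBoundedFromRestTG.LimitInherits

open Summit.AnomalousDissipation.AnomalousDissipation.Theorems.TaylorGreenLoudGalerkinStates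
open Summit.AnomalousDissipation.AnomalousDissipation.Theorems.TaylorGreenLoudGalerkinStates.Negative
open Summit.AnomalousDissipation.AnomalousDissipation.Theorems.TaylorGreenLoudGalerkinStates.TgForceRegular
open Summit.AnomalousDissipation.AnomalousDissipation.Theorems.TaylorGreenLoudGalerkinStates.Criticality
open Summit.AnomalousDissipation.AnomalousDissipation.Theorems.PumpedMirror.MirrorBoundedFromRestTG.SchemeFromRest

/-! ## §1 Two passages to the limit: Fatou–Parseval, and the mirror relation of coefficients -/

/-- **Fatou–Parseval.** If `vⱼ, w ∈ L²(T³; ℝ³)`, `v̂ⱼ(k) → ŵ(k)` for every `k`, and `∫ |vⱼ|² ≤ E` for all `j`,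
then `∫ |w|² ≤ E`: every finite Parseval partial sum of `w` is the limit of the corresponding partial sums of the
`vⱼ`, each `≤ ∫ |vⱼ|² ≤ E` by Bessel (Robinson–Rodrigo–Sadowski 2016, (4.10); the pattern of
`IsHopfGalerkinScheme.sum_norm_sq_limit_le`). [folklore] -/
theorem integral_norm_sq_le_of_tendsto_mFourierCoeff
    {v : ℕ → UnitAddTorus (Fin 3) → EuclideanSpace ℝ (Fin 3)} {w : UnitAddTorus (Fin 3) → EuclideanSpace ℝ (Fin 3)}
    (hv : ∀ j, MemLp (v j) 2 volume) (hw : MemLp w 2 volume)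
    (hc : ∀ k, Tendsto (fun j => mFourierCoeff (EuclideanSpace.complexify ∘ v j) k) atTop
      (𝓝 (mFourierCoeff (EuclideanSpace.complexify ∘ w) k)))
    {E : ℝ} (hE : ∀ j, ∫ x, ‖v j x‖ ^ 2 ≤ E) : ∫ x, ‖w x‖ ^ 2 ≤ E := by
  refine hasSum_le_of_sum_le (hasSum_sq_norm_mFourierCoeff_complexify hw) fun S => ?_
  have hlim : Tendsto (fun j => ∑ k ∈ S, ‖mFourierCoeff (EuclideanSpace.complexify ∘ v j) k‖ ^ 2)
      atTop (𝓝 (∑ k ∈ S, ‖mFourierCoeff (EuclideanSpace.complexify ∘ w) k‖ ^ 2)) :=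
    tendsto_finsetSum _ fun k _ => ((hc k).norm).pow 2
  refine le_of_tendsto' hlim fun j => ?_
  exact (sum_le_hasSum S (fun k _ => sq_nonneg _) (hasSum_sq_norm_mFourierCoeff_complexify (hv j))).trans (hE j)

/-- **The mirror relation of coefficients passes to pointwise limits**: if `cⱼ(k) → c(k)` for every `k` and
`cⱼ (k R_i) = R (cⱼ k)` for a continuous linear `R`, then `c (k R_i) = R (c k)` (uniqueness of limits).
[folklore] -/
theorem mirror_coeff_of_tendsto {c : ℕ → (Fin 3 → ℤ) → EuclideanSpace ℂ (Fin 3)}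
    {cl : (Fin 3 → ℤ) → EuclideanSpace ℂ (Fin 3)} (R : EuclideanSpace ℂ (Fin 3) →L[ℂ] EuclideanSpace ℂ (Fin 3))
    {i : Fin 3} (hc : ∀ k, Tendsto (fun j => c j k) atTop (𝓝 (cl k)))
    (hm : ∀ j k, c j (Matrix.vecMul k (reflMat i)) = R (c j k)) (k : Fin 3 → ℤ) :
    cl (Matrix.vecMul k (reflMat i)) = R (cl k) := by
  refine tendsto_nhds_unique (hc (Matrix.vecMul k (reflMat i))) ?_
  have h : (fun j => c j (Matrix.vecMul k (reflMat i))) = fun j => R (c j k) := funext fun j => hm j k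
  rw [h]
  exact (R.continuous.tendsto _).comp (hc k)

/-! ## §2 An `L²` field with mirror-related coefficients is `K`-symmetric a.e. -/

/-- A continuous linear map commutes with the Fourier coefficients of an INTEGRABLE vector-valued function:
`𝓕(T ∘ g)(n) = T (𝓕 g (n))` (`ContinuousLinearMap.integral_comp_comm`; the continuous case is
`Torus.mFourierCoeff_comp_clm`). [folklore] -/
theorem mFourierCoeff_comp_clm_of_integrable {g : UnitAddTorus (Fin 3) → EuclideanSpace ℂ (Fin 3)}
    (hg : Integrable g volume) (T : EuclideanSpace ℂ (Fin 3) →L[ℂ] EuclideanSpace ℂ (Fin 3)) (n : Fin 3 → ℤ) :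
    mFourierCoeff (fun x => T (g x)) n = T (mFourierCoeff g n) := by
  have hφ : MemLp (fun x : UnitAddTorus (Fin 3) => mFourier (-n) x) ∞ volume :=
    memLp_top_of_bound (mFourier (-n)).continuous.aestronglyMeasurable 1
      (Eventually.of_forall fun x => ((mFourier (-n)).norm_coe_le_norm x).trans_eq mFourier_norm)
  have hint : Integrable (fun x => mFourier (-n) x • g x) volume := hg.smul_of_top_right hφ
  rw [mFourierCoeff_eq_integral_volume, mFourierCoeff_eq_integral_volume, ← T.integral_comp_comm hint]
  exact integral_congr_ae (Eventually.of_forall fun x => (T.map_smul _ _).symm)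

/-- **An `L²` field with mirror-related Fourier coefficients is `K`-symmetric a.e.** If `v ∈ L²(T³; ℝ³)` and
`v̂ (k R_i) = R_iℂ (v̂ k)` for all `k`, then `v (R_i x) = R_i (v x)` for a.e. `x`: both sides are in `L²`
(`R_i` is measure preserving on `T³` and linear on `ℝ³`) with the same coefficients
(`Torus.mFourierCoeff_comp_mulVecT`, `Torus.complexify_toEuclideanCLM_intCast`), hence agree a.e.
(`Torus.ae_eq_of_mFourierCoeff_complexify_eq`, Grafakos 2014, Prop. 3.2.7). [folklore] -/
theorem ae_mirror_of_mFourierCoeff_mirror {v : UnitAddTorus (Fin 3) → EuclideanSpace ℝ (Fin 3)}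
    (hv : MemLp v 2 volume) (i : Fin 3)
    (h : ∀ k, mFourierCoeff (EuclideanSpace.complexify ∘ v) (Matrix.vecMul k (reflMat i)) =
      Matrix.toEuclideanCLM (n := Fin 3) (𝕜 := ℂ) ((reflMat i).map (Int.cast : ℤ → ℂ))
        (mFourierCoeff (EuclideanSpace.complexify ∘ v) k)) :
    (fun x => v (mulVecT (reflMat i) x)) =ᵐ[volume] fun x => actVec (reflMat i) (v x) := by
  have hdet : (reflMat i).det ≠ 0 := Matrix.det_ne_zero_of_left_inverse (reflMat_mul_self i)
  have h1 : MemLp (fun x => v (mulVecT (reflMat i) x)) 2 volume :=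
    hv.comp_measurePreserving (measurePreserving_mulVecT hdet)
  have h2 : MemLp (fun x => actVec (reflMat i) (v x)) 2 volume :=
    (Matrix.toEuclideanCLM (n := Fin 3) (𝕜 := ℝ) ((reflMat i).map (Int.cast : ℤ → ℝ))).comp_memLp' hv
  refine ae_eq_of_mFourierCoeff_complexify_eq h1 h2 fun k => ?_
  -- right side: `𝓕(cx ∘ R_i ∘ v)(k) = R_iℂ (𝓕(cx ∘ v)(k))`
  have heq : (EuclideanSpace.complexify ∘ fun x => actVec (reflMat i) (v x)) = fun x =>
      Matrix.toEuclideanCLM (n := Fin 3) (𝕜 := ℂ) ((reflMat i).map (Int.cast : ℤ → ℂ))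
        ((EuclideanSpace.complexify ∘ v) x) :=
    funext fun x => complexify_toEuclideanCLM_intCast (reflMat i) (v x)
  have hr : mFourierCoeff (EuclideanSpace.complexify ∘ fun x => actVec (reflMat i) (v x)) k =
      Matrix.toEuclideanCLM (n := Fin 3) (𝕜 := ℂ) ((reflMat i).map (Int.cast : ℤ → ℂ))
        (mFourierCoeff (EuclideanSpace.complexify ∘ v) k) := by
    rw [heq]
    exact mFourierCoeff_comp_clm_of_integrable (integrable_complexify_comp (hv.integrable one_le_two)) _ k
  -- left side: `𝓕(cx ∘ v ∘ R_i)(k) = 𝓕(cx ∘ v)(k R_i)`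
  rw [hr, ← h k]
  exact mFourierCoeff_comp_mulVecT (reflMat_mul_self i) (EuclideanSpace.complexify ∘ v) k

/-- The crux's coordinatewise symmetry clause says `IsKSymm`: `U (R_i x) = R_i (U x)`. [folklore] -/
theorem isKSymm_of_coord {U : UnitAddTorus (Fin 3) → EuclideanSpace ℝ (Fin 3)}
    (h : ∀ (i j : Fin 3) (x : UnitAddTorus (Fin 3)),
      U (Function.update x i (-x i)) j = if j = i then -(U x j) else U x j) : IsKSymm U := by
  intro i x
  ext j
  rw [← update_neg_eq_mulVecT, actVec_reflMat_apply]
  exact h i j x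

/-! ## §3 The registered stub -/

/-- **Stub C — a bounded `K`-symmetric scheme has a bounded `K`-symmetric Leray–Hopf limit** (the `Fix K` twin
of `IsHopfGalerkinScheme.exists_invariant_limitField` + `isLerayHopfOn_limit` + the `H`-lift of
`exists_energySpace_lift_of_isGlobalLerayHopf_zero`, with the Fatou–Parseval passage of the pathwise bound;
Robinson–Rodrigo–Sadowski 2016, Thm. 4.4 Steps 3–4): for `ν > 0` and an exact-force Hopf–Galerkin scheme for
`(ν, f_TG, 0)` with pointwise `K`-symmetric slices and `∫ |U n t|² ≤ E` for all `n` and `t ≥ 0`, there is a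
global Leray–Hopf solution from rest with an `H`-lift, `K`-symmetric a.e., with `‖V t‖² ≤ E` for all `t ≥ 0`.
[folklore] -/
theorem stub_limitInheritsMirrorBound :
    ∀ f : UnitAddTorus (Fin 3) → EuclideanSpace ℝ (Fin 3), f = (fun x => !₂[(fourier 1 (x 0) : ℂ).im * (fourier 1 (x 1) : ℂ).re * (fourier 1 (x 2) : ℂ).re, -((fourier 1 (x 0) : ℂ).re * (fourier 1 (x 1) : ℂ).im * (fourier 1 (x 2) : ℂ).re), (0 : ℝ)]) →
      ∀ (ν E : ℝ), 0 < ν →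
        ∀ (N : ℕ → ℕ) (U : ℕ → ℝ → UnitAddTorus (Fin 3) → EuclideanSpace ℝ (Fin 3)),
          Literature.Analysis.FluidPDE.IsHopfGalerkinScheme ν (fun _ => f) 0 N (fun _ _ => f) U →
          (∀ (n : ℕ) (t : ℝ), 0 ≤ t → ∀ (i j : Fin 3) (x : UnitAddTorus (Fin 3)),
            U n t (Function.update x i (-x i)) j = if j = i then -(U n t x j) else U n t x j) →
          (∀ (n : ℕ) (t : ℝ), 0 ≤ t → ∫ x, ‖U n t x‖ ^ 2 ≤ E) →
          ∃ (u : ℝ → UnitAddTorus (Fin 3) → EuclideanSpace ℝ (Fin 3)) (V : ℝ → Literature.Analysis.FunctionSpaces.Torus.energySpace (Fin 3)),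
            Literature.Analysis.FluidPDE.Torus.IsGlobalLerayHopf ν (fun _ => f) 0 u ∧
            (∀ t, 0 ≤ t → ((V t : MeasureTheory.Lp (EuclideanSpace ℝ (Fin 3)) 2 (MeasureTheory.volume : MeasureTheory.Measure (UnitAddTorus (Fin 3)))) : UnitAddTorus (Fin 3) → EuclideanSpace ℝ (Fin 3)) =ᵐ[MeasureTheory.volume] u t) ∧
            (∀ t, 0 ≤ t → ∀ i j : Fin 3, (fun x => ((V t : MeasureTheory.Lp (EuclideanSpace ℝ (Fin 3)) 2 (MeasureTheory.volume : MeasureTheory.Measure (UnitAddTorus (Fin 3)))) : UnitAddTorus (Fin 3) → EuclideanSpace ℝ (Fin 3)) (Function.update x i (-x i)) j) =ᵐ[MeasureTheory.volume] (fun x => if j = i then -(((V t : MeasureTheory.Lp (EuclideanSpace ℝ (Fin 3)) 2 (MeasureTheory.volume : MeasureTheory.Measure (UnitAddTorus (Fin 3)))) : UnitAddTorus (Fin 3) → EuclideanSpace ℝ (Fin 3)) x j) else ((V t : MeasureTheory.Lp (EuclideanSpace ℝ (Fin 3)) 2 (MeasureTheory.volume : MeasureTheory.Measure (UnitAddTorus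 (Fin 3)))) : UnitAddTorus (Fin 3) → EuclideanSpace ℝ (Fin 3)) x j)) ∧
            (∀ t, 0 ≤ t → ‖V t‖ ^ 2 ≤ E) := by
  intro f hf ν E hν N U hS hsym hbd
  obtain rfl : f = tgForce := hf
  -- standing data: zero datum, steady smooth force
  have hu₀ : MemLp (0 : UnitAddTorus (Fin 3) → EuclideanSpace ℝ (Fin 3)) 2 volume := MemLp.zero
  have hdiv : IsWeaklyDivFree (0 : UnitAddTorus (Fin 3) → EuclideanSpace ℝ (Fin 3)) := fun θ _ => by simp
  have hfm : AEStronglyMeasurable (stLift (fun _ : ℝ => tgForce)) (volume.restrict (Ioi 0 ×ˢ univ)) :=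
    aestronglyMeasurable_stLift_const isSmooth_tgForce _
  have hf₂ : ∀ T : ℝ, 0 < T → ∫⁻ _ in Ioo 0 T, ∫⁻ x, ‖tgForce x‖ₑ ^ 2 < ⊤ := fun T _ =>
    lintegral_enorm_sq_const_lt_top isSmooth_tgForce T
  -- (1) the limit field along a subsequence, (2) Leray–Hopf on every `[0, T)`
  obtain ⟨φ, hφ, u, hum, hu, hc⟩ := hS.exists_limitField hν.le hu₀ hfm hf₂
  have hS' := hS.comp_strictMono hφ
  have hLH : IsGlobalLerayHopf ν (fun _ => tgForce) 0 u := fun T hT =>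
    hS'.isLerayHopfOn_limit hν hu₀ hdiv hfm hf₂ hum hu hc hT
  -- (3) the `H`-lift
  obtain ⟨V, hV⟩ := exists_energySpace_lift_of_isGlobalLerayHopf_zero isSmooth_tgForce hasZeroMean_tgForce hLH
  -- (4) the pathwise bound passes to the limit (Fatou–Parseval)
  have hbdu : ∀ t, 0 ≤ t → ∫ x, ‖u t x‖ ^ 2 ≤ E := fun t ht =>
    integral_norm_sq_le_of_tendsto_mFourierCoeff (fun j => hS'.memLp_slice j ht) (hu t ht) (hc t ht)
      fun j => hbd (φ j) t ht
  -- (5) the mirror relation of the coefficients passes to the limit, slice by slice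
  set R : Fin 3 → (EuclideanSpace ℂ (Fin 3) →L[ℂ] EuclideanSpace ℂ (Fin 3)) :=
    fun i => Matrix.toEuclideanCLM (n := Fin 3) (𝕜 := ℂ) ((reflMat i).map (Int.cast : ℤ → ℂ)) with hR_def
  have hR : ∀ (i : Fin 3) (v : EuclideanSpace ℂ (Fin 3)) (j : Fin 3), R i v j = if j = i then -v j else v j :=
    fun i v j => toEuclideanCLM_reflMat_apply i v j
  have hcoefU : ∀ (n : ℕ) (t : ℝ), 0 ≤ t → ∀ (i : Fin 3) (k : Fin 3 → ℤ),
      mFourierCoeff (EuclideanSpace.complexify ∘ U n t) (Matrix.vecMul k (reflMat i)) =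
        R i (mFourierCoeff (EuclideanSpace.complexify ∘ U n t) k) := fun n t ht i k =>
    mFourierCoeff_mirror_of_isKSymm hR (hS.continuous_slice n ht) (isKSymm_of_coord (hsym n t ht)) i k
  have hcoefu : ∀ (t : ℝ), 0 ≤ t → ∀ (i : Fin 3) (k : Fin 3 → ℤ),
      mFourierCoeff (EuclideanSpace.complexify ∘ u t) (Matrix.vecMul k (reflMat i)) =
        R i (mFourierCoeff (EuclideanSpace.complexify ∘ u t) k) := fun t ht i k =>
    mirror_coeff_of_tendsto (c := fun j k => mFourierCoeff (EuclideanSpace.complexify ∘ U (φ j) t) k) (R i)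
      (hc t ht) (fun j k => hcoefU (φ j) t ht i k) k
  have hae : ∀ (t : ℝ), 0 ≤ t → ∀ i : Fin 3,
      (fun x => u t (mulVecT (reflMat i) x)) =ᵐ[volume] fun x => actVec (reflMat i) (u t x) := fun t ht i =>
    ae_mirror_of_mFourierCoeff_mirror (hu t ht) i (hcoefu t ht i)
  refine ⟨u, V, hLH, hV, fun t ht i j => ?_, fun t ht => ?_⟩
  · -- transport the a.e. symmetry to the lift along `V t = u t` a.e. (`R_i` is measure preserving)
    have hdet : (reflMat i).det ≠ 0 := Matrix.det_ne_zero_of_left_inverse (reflMat_mul_self i)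
    have h1 := (measurePreserving_mulVecT hdet).quasiMeasurePreserving.ae_eq_comp (hV t ht)
    have h3 := (hV t ht).symm.fun_comp (actVec (reflMat i))
    filter_upwards [h1, hae t ht i, h3] with x hx1 hx2 hx3
    simp only [Function.comp_apply] at hx1 hx3
    rw [update_neg_eq_mulVecT, hx1, hx2, hx3, actVec_reflMat_apply]
  · -- `‖V t‖² = ∫ |u t|² ≤ E`
    rw [Submodule.coe_norm, ← integral_norm_sq_eq_norm_lift_sq hV ht]
    exact hbdu t ht

end Summit.AnomalousDissipation.AnomalousDissipation.Theorems.PumpedMirror.MirrorBoundedFromRestTG.LimitInherits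

end
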